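import Summits.CriticalPhenomena.SAWScalingLimit.Theses.SAWRenewalTightness
import Summits.CriticalPhenomena.SAWScalingLimit.Theorems.SAWRenewalTightnessShellCrossingBoundTravCount

/-!
# `EventualTight`, line `Sketch`, stub S2 `stub_shellCountOfMultiShadow`: confinement and the
# multi-strand shadowing atom give per-shell traversal-count tightness

Crux item `stmt-CriticalPhenomena-1372` (`SAWRenewalTightness.EventualTight`), line `Sketch`
(registered skeleton `Cruxes/EventualTight/Lines/Sketch.lean`), stub S2.  The statement is the glue
`Confinement → MultiShadowDecay → ShellCountTight` of the skeleton with its local `def`s unfolded: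

* hypothesis 1 (`Confinement`, stub S1): for every Dobrushin domain `D` and endpoint approximation
  `(a_δ, b_δ)` there are `L` and `δc > 0` such that every SAW polyline of `Ω_δ` from `a_δ` to `b_δ`,
  `δ ∈ (0, δc]`, lies in the disc `B̄(0, L)`;
* hypothesis 2 (`MultiShadowDecay`, the atom S3): for every genuine shell `D(x; r, R)` and `θ > 0`
  there are ONE resolution `η > 0`, a number of strands `j` and a mesh threshold `δ₁ > 0` such that
  `P_δ[j pairwise mutually η-shadowing separate traversal strands of D(x; r, R)] ≤ θ` for
  `δ ∈ (0, δ₁]`;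
* conclusion (`ShellCountTight`): there is `δ₀ > 0` (here `δ₀ = 1`; any value works) such that for
  every genuine shell and `θ > 0` some `k` makes `P_δ[k separate traversals] ≤ θ` for all
  `δ ∈ (0, δ₀]`.

Proof.  (A) `exists_shadowingFamily_of_hasTraversals`, the generalised hyperspace pigeonhole
(deterministic): in a compact region `Λ` with a finite `η/2`-net `T`, code each traversal strand by
the set of net points it comes `η/2`-close to; two strands with the same code are mutually
`η`-shadowing (every point of one is `η/2`-close to a net point of its code, which is `η/2`-close to
a point of the other).  With `C = 2^{#T}` codes, `C · j + 1` separate traversals contain `j + 1 > j`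
strands with one code (`Finset.exists_lt_card_fiber_of_mul_lt_card_of_maps_to`); listing `j` of them
increasingly (`Finset.orderEmbOfFin`) gives a time-ordered, pairwise mutually `η`-shadowing family
of `j` traversal strands.  (B) Coarse meshes are free: for `δ ≥ min δ₁ δc` NO self-avoiding polyline
makes `N(ρ, min δ₁ δc)` traversals (`stub_travCount`, the Aizenman–Burchard short-distance cutoff,
landed in `Theorems/SAWRenewalTightnessShellCrossingBoundTravCount.lean`).  (C) With
`k = max k₁ N`, `k₁` from (A) for `Λ = B̄(0, L)`: for `δ ≤ min δ₁ δc` the event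
`{k traversals}` is contained in `{j shadowing strands}` (confinement + (A)), of probability `≤ θ`
(atom); for `δ > min δ₁ δc` it is empty by (B).

No definitions here; tree vocabulary only (`SAW.law`, `SAW.DomainSAW`, `SAW.IsEndpointApprox`,
`meshPoint`, `Curve.IsTraversal/HasTraversals/range`).  Sources: M. Aizenman, A. Burchard,
*Hölder regularity and dimension bounds for random curves*, Duke Math. J. 99 (1999), §1;
the coding-by-a-net pigeonhole is standard (total boundedness of the hyperspace of a compactum).
[folklore]
-/

noncomputable section

open MeasureTheory Filter Topology Set Metric
open scoped ENNReal NNReal unitInterval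
open Literature.Probability.RandomPlanarGeometry Literature.Probability.LatticeModels

namespace Summit.CriticalPhenomena.SAWScalingLimit.Theorems

/-! ### (A) The generalised hyperspace pigeonhole -/

/-- **Equal codes shadow each other.**  If the range of `γ` is covered by the open `η/2`-balls about
the points of `T`, and two parameter intervals `[s₁, t₁]`, `[s₂, t₂]` have the property that every
net point `p ∈ T` that is `η/2`-close to a point of `γ|[s₁, t₁]` is also `η/2`-close to a point of
`γ|[s₂, t₂]`, then every point of `γ|[s₁, t₁]` is within `η` of a point of `γ|[s₂, t₂]` (triangle
inequality through the net point). [folklore] -/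
theorem exists_dist_le_of_net_code_subset {γ : Curve ℂ} {T : Set ℂ} {η : ℝ}
    (hcov : γ.range ⊆ ⋃ p ∈ T, Metric.ball p (η / 2)) {s₁ t₁ s₂ t₂ : I}
    (hcode : ∀ p ∈ T, (∃ u : I, s₁ ≤ u ∧ u ≤ t₁ ∧ dist (γ u) p < η / 2) →
      ∃ v : I, s₂ ≤ v ∧ v ≤ t₂ ∧ dist (γ v) p < η / 2)
    (u : I) (hsu : s₁ ≤ u) (hut : u ≤ t₁) :
    ∃ v : I, s₂ ≤ v ∧ v ≤ t₂ ∧ dist (γ u) (γ v) ≤ η := by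
  have hmem : γ u ∈ γ.range := ⟨u, rfl⟩
  obtain ⟨p, hpT, hpu⟩ := Set.mem_iUnion₂.1 (hcov hmem)
  have h1 : dist (γ u) p < η / 2 := by simpa [Metric.mem_ball] using hpu
  obtain ⟨v, hsv, hvt, hv⟩ := hcode p hpT ⟨u, hsu, hut, h1⟩
  refine ⟨v, hsv, hvt, ?_⟩
  calc dist (γ u) (γ v) ≤ dist (γ u) p + dist (γ v) p := dist_triangle_right _ _ _
    _ ≤ η := by linarith

/-- **Generalised hyperspace pigeonhole** (the `j`-strand version of the line's
`shadowingPigeonhole_holds`).  For a compact region `Λ`, a resolution `η > 0` and a number of strands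
`j` there is `k` (namely `2^{#T} · j + 1` for a finite `η/2`-net `T` of `Λ`) such that every curve in
`Λ` with `k` separate traversals of the shell `D(x; r, R)` has `j` separate traversal strands, listed
in increasing time order, that are PAIRWISE mutually `η`-shadowing: every point of strand `i` is
within `η` of some point of strand `i'`, for all `i, i'`.  Proof: code each strand by the set of net
points it comes `η/2`-close to; by the pigeonhole principle counted by heads some code has a fibre of
more than `j` strands; list `j` of them increasingly; equal codes shadow each other
(`exists_dist_le_of_net_code_subset`). [folklore] -/
theorem exists_shadowingFamily_of_hasTraversals {Λ : Set ℂ} (hΛ : IsCompact Λ) (x : ℂ) (r R : ℝ)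
    {η : ℝ} (hη : 0 < η) (j : ℕ) :
    ∃ k : ℕ, ∀ γ : Curve ℂ, γ.range ⊆ Λ → γ.HasTraversals k x r R →
      ∃ s t : Fin j → I, (∀ i, γ.IsTraversal x r R (s i) (t i)) ∧
        (∀ ⦃i i' : Fin j⦄, i < i' → t i < s i') ∧
        ∀ (i i' : Fin j) (u : I), s i ≤ u → u ≤ t i →
          ∃ v : I, s i' ≤ v ∧ v ≤ t i' ∧ dist (γ u) (γ v) ≤ η := by
  obtain ⟨T, -, hTfin, hTcov⟩ := finite_cover_balls_of_compact hΛ (half_pos hη)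
  classical
  obtain ⟨C, hC⟩ : ∃ C : ℕ, hTfin.toFinset.powerset.card = C := ⟨_, rfl⟩
  refine ⟨C * j + 1, fun γ hγΛ hk => ?_⟩
  obtain ⟨s, t, hst, hsep⟩ := hk
  have hcov : γ.range ⊆ ⋃ p ∈ T, Metric.ball p (η / 2) := hγΛ.trans hTcov
  -- the code of a strand: the net points it comes `η/2`-close to
  let code : Fin (C * j + 1) → Finset ℂ := fun i =>
    hTfin.toFinset.filter (fun p => ∃ u : I, s i ≤ u ∧ u ≤ t i ∧ dist (γ u) p < η / 2)
  have hmaps : ∀ i ∈ (Finset.univ : Finset (Fin (C * j + 1))),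
      code i ∈ hTfin.toFinset.powerset := fun i _ =>
    Finset.mem_powerset.2 (Finset.filter_subset _ _)
  have hcard : hTfin.toFinset.powerset.card * j <
      (Finset.univ : Finset (Fin (C * j + 1))).card := by
    rw [Finset.card_univ, Fintype.card_fin, hC]
    exact Nat.lt_succ_self _
  -- a code with a fibre of more than `j` strands
  obtain ⟨y, -, hy⟩ := Finset.exists_lt_card_fiber_of_mul_lt_card_of_maps_to hmaps hcard
  obtain ⟨F, hF, hjF⟩ : ∃ F : Finset (Fin (C * j + 1)), (∀ i ∈ F, code i = y) ∧ j < F.card :=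
    ⟨_, fun i hi => (Finset.mem_filter.1 hi).2, hy⟩
  -- list `j` strands of the fibre increasingly
  let φ : Fin j → Fin (C * j + 1) := fun i => F.orderEmbOfFin rfl (Fin.castLE hjF.le i)
  have hφmono : StrictMono φ := fun i i' h =>
    (F.orderEmbOfFin rfl).strictMono ((Fin.castLE_lt_castLE_iff hjF.le).2 h)
  have hφcode : ∀ i, code (φ i) = y := fun i => hF _ (F.orderEmbOfFin_mem rfl _)
  -- equal codes shadow each other
  have close : ∀ {i i' : Fin (C * j + 1)}, code i = code i' →
      ∀ u : I, s i ≤ u → u ≤ t i → ∃ v : I, s i' ≤ v ∧ v ≤ t i' ∧ dist (γ u) (γ v) ≤ η := by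
    intro i i' h u hsu hut
    refine exists_dist_le_of_net_code_subset hcov (fun p hpT hp => ?_) u hsu hut
    have hpi : p ∈ code i := Finset.mem_filter.2 ⟨hTfin.mem_toFinset.2 hpT, hp⟩
    rw [h] at hpi
    exact (Finset.mem_filter.1 hpi).2
  refine ⟨s ∘ φ, t ∘ φ, fun i => hst _, fun i i' h => hsep (hφmono h), fun i i' u hsu hut => ?_⟩
  exact close ((hφcode i).trans (hφcode i').symm) u hsu hut

/-! ### The registered stub -/

/-- **S2 `stub_shellCountOfMultiShadow` (`ShellCountOfMultiShadow` of the line `Sketch`, with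
`Confinement`, `MultiShadowDecay`, `HasShadowingFamily`, `ShellCountTight` unfolded).**  If for
small meshes every critical SAW polyline of `Ω_δ` from `a_δ` to `b_δ` lies in one compact disc
`B̄(0, L)` (confinement), and for every genuine shell and `θ > 0` some resolution `η > 0`, strand
number `j` and mesh threshold `δ₁ > 0` make `j` pairwise mutually `η`-shadowing separate traversal
strands `θ`-improbable for `δ ∈ (0, δ₁]` (the atom), then for every genuine shell and `θ > 0` some
`k` makes `k` separate traversals `θ`-improbable for all `δ ∈ (0, 1]`: for `δ ≤ min δ₁ δc` by the
generalised hyperspace pigeonhole `exists_shadowingFamily_of_hasTraversals` in `B̄(0, L)`, for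
coarser meshes because the event is empty (`stub_travCount`, the Aizenman–Burchard short-distance
cutoff, AB99 §1.a). [folklore] -/
theorem stub_shellCountOfMultiShadow :
    (∀ (D : DobrushinDomain) (a b : ℝ → Site 2), SAW.IsEndpointApprox D a b →
      ∃ (L δ₀ : ℝ), 0 < δ₀ ∧ ∀ δ ∈ Set.Ioc (0 : ℝ) δ₀,
        ∀ γ : SAW.DomainSAW D.carrier δ (a δ) (b δ),
          (⟨γ.walk.toCurve (meshPoint δ)⟩ : Curve ℂ).range ⊆ Metric.closedBall (0 : ℂ) L) →
    (∀ (D : DobrushinDomain) (a b : ℝ → Site 2), SAW.IsEndpointApprox D a b →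
      ∀ (x : ℂ) (r R : ℝ), 0 < r → r < R → ∀ θ : ℝ, 0 < θ →
        ∃ η : ℝ, 0 < η ∧ ∃ (j : ℕ) (δ₁ : ℝ), 0 < δ₁ ∧ ∀ δ ∈ Set.Ioc (0 : ℝ) δ₁,
          SAW.law D.carrier δ (a δ) (b δ)
            {γ | ∃ s t : Fin j → unitInterval,
              (∀ i, (⟨γ.walk.toCurve (meshPoint δ)⟩ : Curve ℂ).IsTraversal x r R (s i) (t i)) ∧
              (∀ ⦃i i' : Fin j⦄, i < i' → t i < s i') ∧
              ∀ (i i' : Fin j) (u : unitInterval), s i ≤ u → u ≤ t i →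
                ∃ v : unitInterval, s i' ≤ v ∧ v ≤ t i' ∧
                  dist ((⟨γ.walk.toCurve (meshPoint δ)⟩ : Curve ℂ) u)
                    ((⟨γ.walk.toCurve (meshPoint δ)⟩ : Curve ℂ) v) ≤ η}
            ≤ ENNReal.ofReal θ) →
    ∀ (D : DobrushinDomain) (a b : ℝ → Site 2), SAW.IsEndpointApprox D a b →
      ∃ δ₀ : ℝ, 0 < δ₀ ∧ ∀ (x : ℂ) (ρ R : ℝ), 0 < ρ → ρ < R → ∀ η : ℝ, 0 < η →
        ∃ k : ℕ, ∀ δ ∈ Set.Ioc (0 : ℝ) δ₀,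
          SAW.law D.carrier δ (a δ) (b δ)
            {γ | (⟨γ.walk.toCurve (meshPoint δ)⟩ : Curve ℂ).HasTraversals k x ρ R}
            ≤ ENNReal.ofReal η := by
  intro hConf hAtom D a b hab
  obtain ⟨L, δc, hδc, hconf⟩ := hConf D a b hab
  refine ⟨1, one_pos, fun x ρ R hρ hρR θ hθ => ?_⟩
  obtain ⟨η, hη, j, δ₁, hδ₁, hbound⟩ := hAtom D a b hab x ρ R hρ hρR θ hθ
  -- (A) the pigeonhole threshold in the confining disc
  obtain ⟨k₁, hk₁⟩ :=
    exists_shadowingFamily_of_hasTraversals (isCompact_closedBall (0 : ℂ) L) x ρ R hη j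
  -- (B) the coarse-mesh cutoff above the mesh floor `min δ₁ δc`
  obtain ⟨N, hN⟩ := stub_travCount ρ (min δ₁ δc) hρ (lt_min hδ₁ hδc)
  refine ⟨max k₁ N, fun δ hδ => ?_⟩
  by_cases hle : δ ≤ min δ₁ δc
  · -- fine meshes: `k` traversals ⊆ `j` shadowing strands, of probability `≤ θ`
    refine le_trans (measure_mono fun γ hγ => ?_) (hbound δ ⟨hδ.1, hle.trans (min_le_left _ _)⟩)
    exact hk₁ _ (hconf δ ⟨hδ.1, hle.trans (min_le_right _ _)⟩ γ)
      (Curve.HasTraversals.of_le hγ (le_max_left _ _))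
  · -- coarse meshes: the event is empty
    have hlt : min δ₁ δc < δ := lt_of_not_ge hle
    have hempty : {γ : SAW.DomainSAW D.carrier δ (a δ) (b δ) |
        (⟨γ.walk.toCurve (meshPoint δ)⟩ : Curve ℂ).HasTraversals (max k₁ N) x ρ R} = ∅ :=
      Set.eq_empty_of_forall_notMem fun γ hγ =>
        hN D.carrier δ (a δ) (b δ) γ x R hlt.le hρR
          (Curve.HasTraversals.of_le hγ (le_max_right _ _))
    rw [hempty, measure_empty]
    exact zero_le

end Summit.CriticalPhenomena.SAWScalingLimit.Theorems

end
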